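import Literature.MathematicalPhysics.QuantumFieldTheory.Balaban1983to89.B9Thm312WholeStepRegular
import Literature.MathematicalPhysics.QuantumFieldTheory.Balaban1983to89.B9Thm312WholeClasses

/-!
# `Balaban1983to89.B9Thm312WholeSeriesRegular` — [B9] Theorem 3.12: THE CONVERGENCE OF THE SERIES (3.130) ∕ (3.138) (the pins `HasRWExpOfOps`,
# `HasRWExpHOfOps`) FROM THE PERTURBATION STEP OVER A REGULAR STATE CLASS — `B9Thm312WholeLeaf.seriesConv_of_step ∕ hasRWExp_of_schemas ∕
# hasRWExpH_of_schemas` with the raw state 𝔠⁽ᵖ⁾ replaced by a free block norm 𝔖 carrying an a-priori majorant and a sup reading (LOCATED-U8′)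

T. Bałaban, *Propagators for lattice gauge theories in a background field*, Commun. Math. Phys. **99** (1985) 389–434 [`Balaban1985BackgroundPropagators`,
"B9"]; [4] = T. Bałaban, *Propagators and renormalization transformations for lattice gauge theories. II*, Commun. Math. Phys. **96** (1984) 223–250
[`Balaban1984PropagatorsII`].  statement-level skeleton of published theorems with citation tags; proofs where landed; nothing here is a claim about the
Yang–Mills mass gap.  Sequel of `B9Thm312WholeLeaf` (g0) and `B9Thm312WholeStepRegular` (g26).

THE PRINT.  p. 422: *"This inequality and Theorem 3.3 for G₀ imply a convergence of the series (3.130), for α₀ sufficiently small, in all norms appearing on the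
left-hand sides of the inequalities (3.42)–(3.47)"*; p. 423: the same for (3.138); [4] (2.66) p. 234 (*"the representation (2.50) is convergent in the norms"*).

THE POINT (dag-n06-l LOCATED-U8′).  `seriesConv_of_step` needs the step majorant `G₀T : 𝔠⁽ᵖ⁾ → 𝔠⁽ᵖ⁾` on the RAW class — for T = Δ′_π + Δ⁽²⁾_π beyond print.  The
convergence is a statement about the STATE norm: with `G₀T : 𝔖 → 𝔖` (θe^{−δ_K d}, `StepS`), an a-priori majorant of A out of the sharp class INTO 𝔖 (the finite-dimensional
remark behind [4] (2.66), `B9SmoothHolderClassStateDominated.exists_hasMaj_const_state` at the pins) and ANY sup reading `id : 𝔖 → 𝔠^{(−2)}` (to pass from 𝔖-sizes to point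
values on the finite lattice), the remainder (G₀T)ᴺA f → 0 pointwise when κ_S·θ·c < 1, hence Σ_{n<N}(G₀T)ⁿG₀f → Af.
* §1 ★ `seriesConv_of_stepS`; ★ `hasRWExp_of_stepS` (the pin `HasRWExpOfOps` from `StepS` + `Identities`); ★ `hasRWExpH_of_stepS` (the pin `HasRWExpHOfOps`);
* §2 `hasMaj_of_src_dominated`, ★ `exists_hasMaj_const_of_dom_src` (the a-priori majorant of `hasMaj_right_of_stepS` out of an input class dominating the sharp sup class).
HONEST SCOPE.  Bookkeeping on a finite lattice; the step, the a-priori majorants and the reading are HYPOTHESES; nothing of [B9]∕[4] asserted; no pin, no certificate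
edit; COUNT-NEUTRAL; N06 NOT discharged; one finite lattice at a time — nothing continuum ∕ OS ∕ mass gap.  Cell `pub-ymgap` (HUMAN RULING D-0062), Track A node N06 [B9],
bundle F7 rows 20–21, seat `pub-ymgap-dag-n06-l` (g27), 2026-08-29.  NEW file; nothing landed is modified.
-/

namespace Literature.MathematicalPhysics.QuantumFieldTheory.Balaban1983to89.B9Thm312WholeSeriesRegular

open Literature.MathematicalPhysics.QuantumFieldTheory.Balaban1983to89
open Finset Filter B6RandomWalk B6RandomWalkHom B9Thm34Ext B9Thm37GlueCor36 B11SectG B9SectDSup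
open B9Thm37AllNorms B9Thm37AllNormsInstances B9FromB6 B9FromB6ModelSignsOn B9SectBStepWhole B9Thm312Whole B9Thm312WholeLeaf
open B9Thm312WholeClasses B9Thm312WholeStepRegular
open _root_.Topology

noncomputable section

variable {g : B9.Geometry} {B : B9.Backgrounds} {X Y Z W : Type}
variable [Fintype X] [Fintype Z] [Fintype W] [Fintype g.Site]

/-! ## §1 The convergence of the series over a regular state -/

omit [Fintype Z] [Fintype W] in
/-- ★ **THE SERIES (3.130) ∕ (3.138) CONVERGES, FROM THE STEP OVER A REGULAR STATE** (pointwise on the finite lattice): the step `G₀T : 𝔖 → 𝔖` (θe^{−δ_K d}), the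
resolvent identity A = G₀ + G₀TA, an a-priori majorant `A : 𝔠⁽⁰⁾ → 𝔖` (constant M₀), a sup reading `id : 𝔖 → 𝔠^{(−2)}` (C_R·e^{−r_R d}), the row sum (2.61) at σ ≦ min(δ_K, r_R)
and κ_S·θ·c < 1 give Σ_{n<N}(G₀T)ⁿG₀f → Af at every point (`B9Thm312WholeLeaf.seriesConv_of_step` is the case 𝔖 = 𝔠⁽ᵖ⁾).
[cite: Balaban1985BackgroundPropagators, (3.130) p.421 + p.422 + (3.138) p.423; Balaban1984PropagatorsII, (2.66) p.234] -/
theorem seriesConv_of_stepS {R₀ : ℝ} {H₀ : Prop} (hG : GeoOK g) {blk : X → g.Site} {𝔖 : BlockNorm (toB6 g R₀ H₀) (X → ℝ)}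
    {G0 T A : Module.End ℝ (X → ℝ)} {θ δK σ c M₀ CR rR : ℝ} (hrow : RowSum (toB6 g R₀ H₀) σ c) (hθ : 0 ≤ θ) (hσδ : σ ≤ δK) (hσR : σ ≤ rR)
    (hM₀ : 0 ≤ M₀) (hCR : 0 ≤ CR)
    (hK : HasMaj 𝔖 𝔖 (G0 ∘ₗ T) (fun a b => θ * Real.exp (-(δK * g.dist a b))))
    (hfix : A = G0 + G0 ∘ₗ T ∘ₗ A) (hap : HasMaj (cNorm R₀ H₀ blk hG.lenle 0) 𝔖 A (fun _ _ => M₀))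
    (hRd : HasMaj 𝔖 (cNormR R₀ H₀ blk hG.lenle (-2)) LinearMap.id (fun a b => CR * Real.exp (-(rR * g.dist a b))))
    (hq : 𝔖.κ * θ * c < 1) : SeriesConv G0 T A := by
  -- adapted from `B9Thm312WholeLeaf.seriesConv_of_step` (the raw class 𝔠⁽ᵖ⁾ replaced by 𝔖 + a sup reading)
  classical
  intro f x
  set K' : Module.End ℝ (X → ℝ) := G0 ∘ₗ T with hK'
  have hfix' : A = G0 + K' ∘ₗ A := hfix
  have hc0 : 0 ≤ c := hrow.nonneg (blk x)
  have hq0 : 0 ≤ 𝔖.κ * θ * c := mul_nonneg (mul_nonneg 𝔖.κ_nonneg hθ) hc0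
  set b₀ := cNorm R₀ H₀ blk hG.lenle 0 with hb₀
  -- the remainder INTO the state class, then read into 𝔠^{(−2)}
  have hrem : ∀ N : ℕ, HasMaj b₀ (cNormR R₀ H₀ blk hG.lenle (-2)) (LinearMap.id ∘ₗ ((K' ^ N) ∘ₗ A))
      (fun _ _ => 𝔖.κ * CR * ((𝔖.κ * θ * c) ^ N * M₀) * c) := by
    intro N
    have h := hasMaj_pow_comp_const (b₁ := b₀) (b₂ := 𝔖) hG.dnn hrow hθ hM₀ hσδ hK hap N
    exact hasMaj_comp_const hG.dnn hrow hCR (mul_nonneg (pow_nonneg hq0 N) hM₀) hσR hRd h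
  have hpiece : ∀ y' : (toB6 g R₀ H₀).Site,
      Tendsto (fun N : ℕ => ((K' ^ N) (A (b₀.cut y' f))) x) atTop (𝓝 0) := by
    intro y'
    have hloc : b₀.IsLoc y' (b₀.cut y' f) := b₀.isLoc_cut y' f
    have hl2 : 0 < g.len (blk x) ^ (-2 : ℝ) := Real.rpow_pos_of_pos (hG.lenpos (blk x)) _
    have hb : ∀ N : ℕ, |((K' ^ N) (A (b₀.cut y' f))) x| ≤
        (g.len (blk x) ^ (-2 : ℝ))⁻¹ * (𝔖.κ * CR * M₀ * c * b₀.loc y' (b₀.cut y' f)) * (𝔖.κ * θ * c) ^ N := by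
      intro N
      have h1 := hrem N y' (b₀.cut y' f) hloc (blk x)
      simp only [LinearMap.comp_apply, LinearMap.id_coe, id_eq, cNormR_loc] at h1
      have h2 : |((K' ^ N) (A (b₀.cut y' f))) x| ≤
          (BlockNorm.ofBlocks (toB6 g R₀ H₀) blk).loc (blk x) ((K' ^ N) (A (b₀.cut y' f))) :=
        abs_apply_le_ofBlocks_loc (G := toB6 g R₀ H₀) blk (blk x) _ x rfl
      have h3 : |((K' ^ N) (A (b₀.cut y' f))) x| ≤
          (g.len (blk x) ^ (-2 : ℝ))⁻¹ * (𝔖.κ * CR * ((𝔖.κ * θ * c) ^ N * M₀) * c * b₀.loc y' (b₀.cut y' f)) :=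
        h2.trans ((le_inv_mul_iff₀ hl2).mpr h1)
      calc |((K' ^ N) (A (b₀.cut y' f))) x|
          ≤ (g.len (blk x) ^ (-2 : ℝ))⁻¹ * (𝔖.κ * CR * ((𝔖.κ * θ * c) ^ N * M₀) * c * b₀.loc y' (b₀.cut y' f)) := h3
        _ = (g.len (blk x) ^ (-2 : ℝ))⁻¹ * (𝔖.κ * CR * M₀ * c * b₀.loc y' (b₀.cut y' f)) * (𝔖.κ * θ * c) ^ N := by ring
    have hlim : Tendsto (fun N : ℕ => (g.len (blk x) ^ (-2 : ℝ))⁻¹ * (𝔖.κ * CR * M₀ * c * b₀.loc y' (b₀.cut y' f)) * (𝔖.κ * θ * c) ^ N)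
        atTop (𝓝 ((g.len (blk x) ^ (-2 : ℝ))⁻¹ * (𝔖.κ * CR * M₀ * c * b₀.loc y' (b₀.cut y' f)) * 0)) :=
      (tendsto_pow_atTop_nhds_zero_of_lt_one hq0 hq).const_mul _
    rw [mul_zero] at hlim
    exact squeeze_zero_norm (fun N => by simpa only [Real.norm_eq_abs] using hb N) hlim
  have hremf : Tendsto (fun N : ℕ => ((K' ^ N) (A f)) x) atTop (𝓝 0) := by
    have heq : (fun N : ℕ => ((K' ^ N) (A f)) x) =
        fun N => ∑ y' : (toB6 g R₀ H₀).Site, ((K' ^ N) (A (b₀.cut y' f))) x := by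
      funext N
      conv_lhs => rw [← b₀.sum_cut f]
      simp only [map_sum, Finset.sum_apply]
    rw [heq]
    simpa using tendsto_finsetSum _ fun y' _ => hpiece y'
  have htel : ∀ N : ℕ, (∑ n ∈ Finset.range N, (K' ^ n) (G0 f)) x = A f x - ((K' ^ N) (A f)) x := by
    intro N
    have h := congrFun (neumann_telescope hfix' N f) x
    rw [Pi.add_apply] at h
    linarith
  show Tendsto (fun N : ℕ => (∑ n ∈ Finset.range N, (K' ^ n) (G0 f)) x) atTop (𝓝 (A f x))
  simp_rw [htel]
  have hlim := (tendsto_const_nhds (x := A f x)).sub hremf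
  rw [sub_zero] at hlim
  exact hlim

omit [Fintype X] [Fintype Z] [Fintype W] [Fintype g.Site] in
/-- A linear map on the finite lattice passes pointwise limits (matrix representation). [folklore] -/
private theorem tendsto_apply_linearMapS [Fintype X] [DecidableEq X] (L : Module.End ℝ (X → ℝ)) {s : ℕ → X → ℝ} {t : X → ℝ}
    (h : ∀ x : X, Tendsto (fun N => s N x) atTop (𝓝 (t x))) (x : X) :
    Tendsto (fun N => L (s N) x) atTop (𝓝 (L t x)) := by
  have hrep : ∀ u : X → ℝ, L u x = ∑ x', LinearMap.toMatrix' L x x' * u x' := fun u => (sum_toMatrix'_mul L u x).symm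
  simp_rw [hrep]
  exact tendsto_finsetSum _ fun x' _ => (h x').const_mul _

/-- ★ **THE PIN `HasRWExpOfOps` FROM THE STEPS OVER A REGULAR STATE**: `StepS 𝔬 𝔖 θ δK U` (both perturbations), the a-priori majorants of G and G₁ INTO 𝔖, the sup
reading of 𝔖, the row sum at σ ≦ min(δ_K, r_R), κ_S·θ·c < 1 and the identities give the convergence of (3.130) to G, of (3.138) to G₁ and of 𝔓·(3.138) to 𝔊 = 𝔓G₁.
[cite: Balaban1985BackgroundPropagators, Thm 3.12 p.423 + (3.130) p.421 + (3.138) p.423 + (3.153) p.426] -/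
theorem hasRWExp_of_stepS [DecidableEq X] {R₀ : ℝ} {H₀ : Prop} (hG : GeoOK g) {𝔬 : Ops g B X Y Z W} {U : B.Cfg}
    {𝔖 : BlockNorm (toB6 g R₀ H₀) (X → ℝ)} {θ δK σ c M₀ M₁ CR rR : ℝ} (hrow : RowSum (toB6 g R₀ H₀) σ c) (hθ : 0 ≤ θ) (hσδ : σ ≤ δK)
    (hσR : σ ≤ rR) (hM₀ : 0 ≤ M₀) (hM₁ : 0 ≤ M₁) (hCR : 0 ≤ CR) (hq : 𝔖.κ * θ * c < 1)
    (hS : StepS 𝔬 𝔖 θ δK U) (hI : Identities 𝔬 U)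
    (hap : HasMaj (cNorm R₀ H₀ 𝔬.blk hG.lenle 0) 𝔖 (𝔬.G U) (fun _ _ => M₀))
    (hap1 : HasMaj (cNorm R₀ H₀ 𝔬.blk hG.lenle 0) 𝔖 (𝔬.G1 U) (fun _ _ => M₁))
    (hRd : HasMaj 𝔖 (cNormR R₀ H₀ 𝔬.blk hG.lenle (-2)) LinearMap.id (fun a b => CR * Real.exp (-(rR * g.dist a b))))
    (K : B9.KernelFamily g B) (δ : ℝ) :
    HasRWExpOfOps 𝔬 K U δ := by
  have hfix := fix_of_inverses hI.invG0' hI.invG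
  have hfix1 := fix_of_inverses hI.invG0' hI.invG1
  have h1 : SeriesConv (𝔬.G0 U) (𝔬.Tpi U) (𝔬.G U) := seriesConv_of_stepS hG hrow hθ hσδ hσR hM₀ hCR hS.step hfix hap hRd hq
  have h2 : SeriesConv (𝔬.G0 U) (𝔬.Tpi U + 𝔬.T2 U) (𝔬.G1 U) :=
    seriesConv_of_stepS hG hrow hθ hσδ hσR hM₁ hCR hS.step1 hfix1 hap1 hRd hq
  refine ⟨h1, h2, fun f x => ?_⟩
  have h3 := tendsto_apply_linearMapS (frakP 𝔬 U) (fun x' => h2 f x') x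
  have h4 : frakP 𝔬 U (𝔬.G1 U f) x = 𝔬.GG U f x := by rw [GG_apply hI]
  rw [h4] at h3
  simpa only [LinearMap.id_coe, id_eq] using h3

/-- ★ **THE PIN `HasRWExpHOfOps` FROM THE STEPS OVER A REGULAR STATE**: H = GQ\*(QGQ\*)⁻¹, H₁ = G₁Q\*(QG₁Q\*)⁻¹ ((3.126), (3.129)) and the convergence of (3.130),
(3.138) over 𝔖 give the convergence of the inserted series to H, H₁.
[cite: Balaban1985BackgroundPropagators, Thm 3.12 p.423 + (3.126) p.420 + (3.129) p.421] -/
theorem hasRWExpH_of_stepS [DecidableEq X] {R₀ : ℝ} {H₀ : Prop} (hG : GeoOK g) {𝔬 : Ops g B X Y Z W} {U : B.Cfg}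
    {𝔖 : BlockNorm (toB6 g R₀ H₀) (X → ℝ)} {θ δK σ c M₀ M₁ CR rR : ℝ} (hrow : RowSum (toB6 g R₀ H₀) σ c) (hθ : 0 ≤ θ) (hσδ : σ ≤ δK)
    (hσR : σ ≤ rR) (hM₀ : 0 ≤ M₀) (hM₁ : 0 ≤ M₁) (hCR : 0 ≤ CR) (hq : 𝔖.κ * θ * c < 1)
    (hS : StepS 𝔬 𝔖 θ δK U) (hI : Identities 𝔬 U)
    (hap : HasMaj (cNorm R₀ H₀ 𝔬.blk hG.lenle 0) 𝔖 (𝔬.G U) (fun _ _ => M₀))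
    (hap1 : HasMaj (cNorm R₀ H₀ 𝔬.blk hG.lenle 0) 𝔖 (𝔬.G1 U) (fun _ _ => M₁))
    (hRd : HasMaj 𝔖 (cNormR R₀ H₀ 𝔬.blk hG.lenle (-2)) LinearMap.id (fun a b => CR * Real.exp (-(rR * g.dist a b))))
    (Hk : B9.HKernel g B) (δ : ℝ) :
    HasRWExpHOfOps 𝔬 Hk U δ := by
  have hfix := fix_of_inverses hI.invG0' hI.invG
  have hfix1 := fix_of_inverses hI.invG0' hI.invG1
  have h1 : SeriesConv (𝔬.G0 U) (𝔬.Tpi U) (𝔬.G U) := seriesConv_of_stepS hG hrow hθ hσδ hσR hM₀ hCR hS.step hfix hap hRd hq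
  have h2 : SeriesConv (𝔬.G0 U) (𝔬.Tpi U + 𝔬.T2 U) (𝔬.G1 U) :=
    seriesConv_of_stepS hG hrow hθ hσδ hσR hM₁ hCR hS.step1 hfix1 hap1 hRd hq
  refine ⟨fun b x => ?_, fun b x => ?_⟩
  · have h := h1 (𝔬.Qstar U (𝔬.C U b)) x
    rw [hI.eq126]
    simpa using h
  · have h := h2 (𝔬.Qstar U (𝔬.C1 U b)) x
    rw [hI.eq129]
    simpa using h

/-! ## §2 A-priori majorants out of a dominating source class -/

omit [Fintype Z] [Fintype W] in
/-- **A MAJORANT PASSES TO A DOMINATING SOURCE CLASS**: if `b₁`'s local sizes are below `b₀`'s and `b₀`-localised vectors are `b₁`-localised, a majorant K ≧ 0 out of `b₁` is a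
majorant out of `b₀` (used for the input classes `bHX ε`, which dominate the sharp sup class: `Letters313IM.domX ∕ locX`). [cite: Balaban1984PropagatorsII, (2.51)–(2.52) p.232 (bookkeeping)] -/
theorem hasMaj_of_src_dominated {R₀ : ℝ} {H₀ : Prop} {F₁ F₂ : Type} [AddCommGroup F₁] [Module ℝ F₁] [AddCommGroup F₂] [Module ℝ F₂]
    {b₀ b₁ : BlockNorm (toB6 g R₀ H₀) F₁} {b₂ : BlockNorm (toB6 g R₀ H₀) F₂} {T : F₁ →ₗ[ℝ] F₂} {K : g.Site → g.Site → ℝ} (hK : ∀ a b, 0 ≤ K a b)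
    (hdom : ∀ y μ, b₁.loc y μ ≤ b₀.loc y μ) (hloc : ∀ y μ, b₀.IsLoc y μ → b₁.IsLoc y μ) (h : HasMaj b₁ b₂ T K) : HasMaj b₀ b₂ T K := by
  intro y' μ hμ y
  exact (h y' μ (hloc y' μ hμ) y).trans (mul_le_mul_of_nonneg_left (hdom y' μ) (hK y y'))

omit [Fintype Z] [Fintype W] in
/-- ★ **THE A-PRIORI MAJORANT OUT OF AN INPUT CLASS** (the `hap` of `hasMaj_right_of_stepS` for F = ∇\*_{U,μ} out of `bHX ε`): a state class dominated by the global ℓ¹ size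
(`hdom`, g26 `exists_state_loc_le_sum` at the pins) and a source class dominating the sharp sup class of its carrier (`hdomX`, `hlocX`) give every operator SOME constant
majorant (the finite-dimensional remark behind [4] (2.66); g26 `exists_hasMaj_const_of_dom` is the case `b₀ = 𝔠_V^{(q)}`). [cite: Balaban1984PropagatorsII, (2.66) p.234 (bookkeeping); Balaban1985BackgroundPropagators, Thm 3.12 p.423] -/
theorem exists_hasMaj_const_of_dom_src {R₀ : ℝ} {H₀ : Prop} (hG : GeoOK g) {V : Type} [Fintype V] (blkV : V → g.Site) (blk : X → g.Site)
    {b₀ : BlockNorm (toB6 g R₀ H₀) (V → ℝ)}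
    (hdomX : ∀ y μ, (BlockNorm.ofBlocks (toB6 g R₀ H₀) blkV).loc y μ ≤ b₀.loc y μ)
    (hlocX : ∀ y μ, b₀.IsLoc y μ → (BlockNorm.ofBlocks (toB6 g R₀ H₀) blkV).IsLoc y μ)
    {𝔖 : BlockNorm (toB6 g R₀ H₀) (X → ℝ)} {Λ : ℝ} (hΛ : 0 ≤ Λ) (hdom : ∀ (y : g.Site) (F : X → ℝ), 𝔖.loc y F ≤ Λ * ∑ x : X, |F x|)
    (T : (V → ℝ) →ₗ[ℝ] (X → ℝ)) : ∃ M₀ : ℝ, 0 ≤ M₀ ∧ HasMaj b₀ 𝔖 T (fun _ _ => M₀) := by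
  obtain ⟨M₀, hM₀, h⟩ := exists_hasMaj_const_of_dom hG blkV blk 0 hΛ hdom T
  refine ⟨M₀, hM₀, hasMaj_of_src_dominated (b₁ := cNorm R₀ H₀ blkV hG.lenle 0) (fun _ _ => hM₀) (fun y μ => ?_)
    (fun y μ hμ => hlocX y μ hμ) h⟩
  have e : (cNorm R₀ H₀ blkV hG.lenle 0).loc y μ = (BlockNorm.ofBlocks (toB6 g R₀ H₀) blkV).loc y μ := by
    simp only [cNorm, weightNorm_loc, wt, pow_zero, inv_one, one_mul]
  exact e.le.trans (hdomX y μ)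

end

end Literature.MathematicalPhysics.QuantumFieldTheory.Balaban1983to89.B9Thm312WholeSeriesRegular
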